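import Summits.QuantumFields.YangMills.Theorems.LuscherReductionTwistedTraceScalingCovariantCurl
import Summits.QuantumFields.YangMills.Theorems.LuscherReductionTwistedTraceScalingToronOrbit
import HarnessLib

/-!
# The covariant curl at a constant abelian background is the TWISTED lattice curl: `Ad(diagSU2 θ)` = rotation by the adjoint phase `2θ` of the
# charged colour plane, `hol(V_θ) = 1`, `S(V_θ) = 0`, and `(D_{V_θ} w)(x;i<j) = w(x,i) + R(2θ_i)w(x+eᵢ,j) − R(2θ_j)w(x+eⱼ,i) − w(x,j)`
# (spectral-bridge brick for the VALLEY term, crux `TwistedTraceScaling` stmt-QuantumFields-20203 S-BASE; design note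
# `pub/ym-fleet/ym-luscher-20007-p1/COARSE-DESIGN.md` §12 (ii))

The Gaussian normalisation at a flat background `V_θ = abelianCfg L θ` (`…ToronOrbit`) is governed by the spectrum of `D_{V_θ}†D_{V_θ}`, `D_U` the covariant
curl of lane B (`TwoLattice.Cov.covCurl`).  This file identifies `D_{V_θ}` explicitly: the parallel transporters of `V_θ` act on colour vectors by
`chargedRot (2θ_k)` — identity on the neutral axis (colour `0`), rotation by the ADJOINT PHASE `2θ_k` on the charged plane (colours `1, 2`) — so `D_{V_θ}` is the
lattice curl with twisted (phase-shifted) forward differences in the charged sector and the plain curl in the neutral one.  Its normal modes are therefore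
the twisted plane waves with eigenvalues `Σ_k (2 − 2cos(p_k + 2θ_k·[charged]))` — the `lap3` of `…ToronMinimality` (the Fourier diagonalisation itself is
left to the consumer of the Gaussian step).
* `chargedRot`, ★ `adRot_diagSU2 : adRot (diagSU2 θ) = chargedRot (2θ)`; `chargedRot_zero`;
* `ptrans1_abelianCfg`, `ptrans2_abelianCfg`, ★ `hol_abelianCfg = 1` (flatness), `wilsonAction_abelianCfg = 0`;
* ★★ `covCurl_abelianCfg_apply` — the twisted-curl formula.

HONEST FRAMING: algebra at fixed `L`; femto rung R2b1 (brick for a stub of a child of a CONDITIONAL route); not a gap, not Clay.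
-/

set_option autoImplicit false

noncomputable section

open Finset
open scoped Matrix ComplexConjugate BigOperators
open Literature.MathematicalPhysics.QuantumFieldTheory
open Literature.MathematicalPhysics.QuantumLattice

namespace Summit.QuantumFields.YangMills.Theorems.FemtoTransferGap.TwoLattice.Toron

open Summit.QuantumFields.YangMills.Theorems.FemtoTransferGap
open Summit.QuantumFields.YangMills.Theorems.FemtoTransferGap.TwoLattice.Cov
open Summit.QuantumFields.YangMills.Theorems.FemtoTransferGap.TwoLattice.Stiff

variable {L : ℕ}

/-! ## §1 The adjoint action of the diagonal subgroup -/

/-- Rotation by `φ` of the charged colour plane (colours `1, 2`), identity on the neutral axis (colour `0`). [folklore] -/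
def chargedRot (φ : ℝ) : Matrix (Fin 3) (Fin 3) ℝ := !![1, 0, 0; 0, Real.cos φ, -Real.sin φ; 0, Real.sin φ, Real.cos φ]

/-- `chargedRot 0 = 1`. [folklore] -/
theorem chargedRot_zero : chargedRot 0 = 1 := by
  ext i j
  fin_cases i <;> fin_cases j <;> simp [chargedRot]

/-- ★ **The adjoint phase is twice the link angle**: `Ad(diag(e^{iθ}, e^{−iθ})) = chargedRot (2θ)`. [cite: BrockerTomDieck1985, I (1.10)] -/
theorem adRot_diagSU2 (θ : ℝ) : adRot (diagSU2 θ) = chargedRot (2 * θ) := by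
  have h00 : (((diagSU2 θ : SU2) : Matrix (Fin 2) (Fin 2) ℂ) 0 0) = Complex.exp (θ * Complex.I) := by simp [coe_diagSU2]
  have h01 : (((diagSU2 θ : SU2) : Matrix (Fin 2) (Fin 2) ℂ) 0 1) = 0 := by simp [coe_diagSU2]
  have hre : (Complex.exp (θ * Complex.I)).re = Real.cos θ := Complex.exp_ofReal_mul_I_re θ
  have him : (Complex.exp (θ * Complex.I)).im = Real.sin θ := Complex.exp_ofReal_mul_I_im θ
  have hcos : Real.cos (2 * θ) = Real.cos θ ^ 2 - Real.sin θ ^ 2 := by rw [Real.cos_two_mul, Real.sin_sq]; ring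
  have hsin : Real.sin (2 * θ) = 2 * Real.sin θ * Real.cos θ := Real.sin_two_mul θ
  have h1 : Real.cos θ ^ 2 + Real.sin θ ^ 2 = 1 := Real.cos_sq_add_sin_sq θ
  unfold adRot
  simp only [h00, h01, hre, him, Complex.zero_re, Complex.zero_im]
  unfold chargedRot
  rw [hcos, hsin]
  ext i j
  fin_cases i <;> fin_cases j <;> simp <;> nlinarith [h1]

/-! ## §2 The constant abelian background is flat; its transporters -/

/-- `P₁(V_θ)(x; i<j) = diagSU2 θ_i`. [folklore] -/
theorem ptrans1_abelianCfg (θ : Fin 3 → ℝ) (p : Plaquette 3 L) : ptrans1 (abelianCfg L θ) p = diagSU2 (θ p.2.1.1) := rfl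

/-- `P₂(V_θ)(x; i<j) = diagSU2 θ_j` (abelian: `θ_i + θ_j − θ_i`). [folklore] -/
theorem ptrans2_abelianCfg (θ : Fin 3 → ℝ) (p : Plaquette 3 L) : ptrans2 (abelianCfg L θ) p = diagSU2 (θ p.2.1.2) := by
  simp only [ptrans2, abelianCfg]
  rw [← diagSU2_neg, ← diagSU2_add, ← diagSU2_add]
  congr 1; ring

/-- ★ **Flatness**: `hol(V_θ) = 1`. [cite: Luscher1983, §2] -/
theorem hol_abelianCfg (θ : Fin 3 → ℝ) (p : Plaquette 3 L) : hol (abelianCfg L θ) p = 1 := by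
  simp only [hol, plaquetteHolonomy, abelianCfg]
  rw [← diagSU2_neg, ← diagSU2_neg, ← diagSU2_add, ← diagSU2_add, ← diagSU2_add, ← diagSU2_zero]
  congr 1; ring

/-- `S(V_θ) = 0`. [cite: Luscher1983, §2] -/
theorem wilsonAction_abelianCfg [NeZero L] (θ : Fin 3 → ℝ) : wilsonAction su2Rep (abelianCfg L θ) = 0 := by
  unfold wilsonAction
  refine sum_eq_zero fun p _ => ?_
  have h : plaquetteHolonomy (abelianCfg L θ) p.1 p.2.1.1 p.2.1.2 = 1 := hol_abelianCfg θ p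
  rw [h]
  simp

/-! ## §3 The covariant curl at `V_θ` is the twisted curl -/

/-- ★★ **Twisted-curl formula**: for the plaquette `(x; i<j)` and colour `a`,
`(D_{V_θ} w)(x;i<j;a) = w(x,i;a) + (R(2θ_i) w(x+eᵢ,j;·))_a − (R(2θ_j) w(x+eⱼ,i;·))_a − w(x,j;a)`, `R = chargedRot`. [cite: Luscher1983, §3] -/
theorem covCurl_abelianCfg_apply (θ : Fin 3 → ℝ) (w : LinkSpace L) (x : Site 3 L) (ij : {q : Fin 3 × Fin 3 // q.1 < q.2}) (a : Fin 3) :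
    covCurl (abelianCfg L θ) w ((x, ij), a) =
      w ((x, ij.1.1), a) + ∑ b, chargedRot (2 * θ ij.1.1) a b * w ((x.shift ij.1.1, ij.1.2), b)
        - ∑ b, chargedRot (2 * θ ij.1.2) a b * w ((x.shift ij.1.2, ij.1.1), b) - w ((x, ij.1.2), a) := by
  rw [covCurl_apply, ptrans1_abelianCfg, ptrans2_abelianCfg, hol_abelianCfg, adRot_diagSU2, adRot_diagSU2, adRot_one]
  congr 1
  simp only [Matrix.one_apply, ite_mul, one_mul, zero_mul, Finset.sum_ite_eq, Finset.mem_univ, if_true]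

/-- At a toron background in the neutral colour `a = 0` the twisted curl is the plain curl: `(D_{V_θ} w)(p; 0) = (d w)(p; 0)`. [folklore] -/
theorem covCurl_abelianCfg_apply_neutral (θ : Fin 3 → ℝ) (w : LinkSpace L) (x : Site 3 L) (ij : {q : Fin 3 × Fin 3 // q.1 < q.2}) :
    covCurl (abelianCfg L θ) w ((x, ij), 0) = latCurl L w ((x, ij), 0) := by
  rw [covCurl_abelianCfg_apply, latCurl_apply]
  simp [chargedRot, Fin.sum_univ_three]

end Summit.QuantumFields.YangMills.Theorems.FemtoTransferGap.TwoLattice.Toron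

end
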